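import Summits.NavierStokesRegularity.FluidComputer.GateBudgetRungClock
import Summits.NavierStokesRegularity.FluidComputer.GateBudgetLadderTwoSided
import HarnessLib

/-!
# GateBudget part 85 — the clock ladder: the two-sided climb with the fine rung clock (§248–§249)

Cell `pub-fluidc`, blueprint seat bp1 (gen 37, fourth item: THE CLOCK LADDER, SPEC-INPUT-bp1
§BN(4)(b)); namespace `Summit.NavierStokesRegularity.FluidComputer.GateBudget`, headline member
`RotorKnob.rotorCircuit K K¹⁰ ε ρ` of the two-scale family from `delayInit` (5.6), `K ≥ 16`, on
the lattice window `200ε/K²⁰ ≤ ρ² ≤ 2ε/K¹⁰`, `ε² ≤ 1/(6K²⁰)`, `ε = kK¹⁰ρ²`; modes `0 = a`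
(carrier), `1 = b` (clock), `2 = c` (trigger), `3 = d` (transfer), `4 = ã` (output).
HONEST FRAMING: a low prior, high value-of-information experiment on Tao's machine paradigm;
NOT a claim that NS blows up.

WHAT. Part 82 §240 climbs the clean misfire ladder with the pair budget on the ledgers and the
CLOCK charged `286/K⁹` per rung (window `(N - 1)·286/K⁹ ≤ 0.14999`). §249
`knob_ladder_climb_clock` is the same induction with part 84's rung: the pulse half (§246, exit
ratio `|θ₁ - θ| ≤ 242 log K/K¹⁰`) glued to the cold half (§247, relight ratio `θ' ≥ θ₁ -
43/K⁹` or clipped to `[1.39999, 1.41422]`) through the one fact the cold half needs and the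
climb owns, `P(T') ≤ 1/50` (from part 82 §239 `pulse_pslip` and the budget). So the clock is
charged `λ = 43/K⁹ + 242 log K/K¹⁰` per rung — window `(N - 1)·λ ≤ 0.14999`, i.e. `N - 1 ≤
1.69·10⁻³K⁹` at `K = 16` (`×3.37` against `5.03·10⁻⁴K⁹`) and `→ 3.35·10⁻³K⁹` (`×6.65`) — and
the pair is charged, per rung, any real `S ≥ (0.2829 + U/K⁹)U/K⁹ + (2D + ι)ι + 6(D + ι +
3/K⁹)/K⁹`: the cold conversion is now part 84's SHARP pair law at dose level `|d(T')| + 3/K⁹ ≤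
D + ι + 3/K⁹` instead of part 82's `6/K⁹` (which was the dominant term of part 83's slip `(7 +
k²/10)/K⁹` at small `k`). §249 `knob_ladder_clock` reads the invariants out uniformly in `n`
exactly as part 82: `P(rₙ) ≤ P₁ + (n - 1)S ≤ 1/50`, `A₀ + (n - 1)/K⁹ ≤ ã(rₙ) ≤ 0.1415`,
`|d(rₙ)| ≤ D`.
HOW. §248 `clock_numerics` (`0 ≤ λ`, `242 log K/K¹⁰ ≤ 10⁻⁶`, `λ ≤ 10⁻⁶`) and
`clock_slip_signs` (`0 ≤ D, U, S` under the three dominations) are pure real analysis; §249 is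
part 82 §240 line by line with part 84 §246 + §247 in place of part 80 §236 — the transfer and
output ledgers (part 81 §237/§238) are untouched, the exit budget `P(T') ≤ P(r) + S - (cold
term) ≤ 1/50` is read before the cold half is called, and the window arithmetic is `θ' ≥ θ₁ -
43/K⁹ ≥ θ - λ`.
READING (SPEC-INPUT-bp1 §BN(4)). Of the clean ladder's two windows the CLOCK one still binds
(`λ ≥ 43/K⁹` from part 60's hard-wired carrier-slope width, one level below this file), but by
`×3.4–6.6` less; the pair window with the sharp cold law is `(N - 1)(11 + k²)/(10K⁹) ≤ 0.0199`
(part 86's numerics), `≈ 0.0166K⁹` at `k = 1`. The remaining clock charge is bookkeeping too: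
the true relight ratio drifts UP and clips at `√(2(1 - P₀))` (part 84's header (ii)).
HONEST LIMITS. (i) `A₀, D₀, P₁, D, U, S` free, constrained by three explicit inequalities — the
numerics and the dud horizon are part 86; (ii) existence per rung, no uniqueness; (iii) the
anchor's standing reserve `s′ = 0.3(η′ + 310 log K/K⁹) + 6/K⁹` is still paid once (part 80's
rung map asks for it); (iv) `43/K⁹` per rung is NOT removed (parts 59/60); (v) nothing about
Navier–Stokes.
[cite: Tao2016AveragedNS, §5.5 Theorem 5.3, (5.5), (5.6), (b-eq), (c-eq), (d-eq), (ta-eq),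
(energy-con), (est)]
-/

noncomputable section

namespace Summit.NavierStokesRegularity.FluidComputer.GateBudget

open Real Set Filter Topology
open Literature.Analysis.FluidPDE.Tao2016AveragedNS

variable {K ε ρ : ℝ} {X : ℝ → Fin 5 → ℝ} {C : ℝ → ℝ}

/-! ## §248 Numerics of the rung clock; signs -/

/-- §248 NUMERICS (`K ≥ 16`): `λ = 43/K⁹ + 242 log K/K¹⁰` has `0 ≤ λ`, `242 log K/K¹⁰ ≤
10⁻⁶`, `λ ≤ 10⁻⁶`. [folklore] -/
theorem clock_numerics (hK : 16 ≤ K) :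
    0 ≤ 43 / K ^ 9 + 242 * log K / K ^ 10 ∧ 242 * log K / K ^ 10 ≤ 1 / 10 ^ 6 ∧
      43 / K ^ 9 + 242 * log K / K ^ 10 ≤ 1 / 10 ^ 6 := by
  have hK0 : (0 : ℝ) < K := by linarith
  have hK9 : (0 : ℝ) < K ^ 9 := by positivity
  have hK10 : (0 : ℝ) < K ^ 10 := by positivity
  have h169 : (16 : ℝ) ^ 9 ≤ K ^ 9 := pow_le_pow_left₀ (by norm_num) hK 9
  have hlogK : 0 ≤ log K := Real.log_nonneg (by linarith)
  have hlog : log K ≤ K := by linarith only [Real.log_le_sub_one_of_pos hK0]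
  have h1 : 242 * log K / K ^ 10 ≤ 242 / K ^ 9 := by
    rw [div_le_div_iff₀ hK10 hK9]
    have := mul_le_mul_of_nonneg_right hlog hK9.le
    have e : K * K ^ 9 = K ^ 10 := by ring
    nlinarith only [this, e, hlogK]
  have h2 : (242 : ℝ) / K ^ 9 + 43 / K ^ 9 ≤ 1 / 10 ^ 6 := by
    rw [← add_div, div_le_div_iff₀ hK9 (by norm_num)]; linarith only [h169]
  have h3 : (0 : ℝ) ≤ 43 / K ^ 9 := by positivity
  have h4 : 0 ≤ 242 * log K / K ^ 10 := by positivity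
  exact ⟨by linarith only [h3, h4], by linarith only [h1, h2, h3], by linarith only [h1, h2]⟩

/-- §248 SIGNS (`K ≥ 16`, `k ≥ 1`, `D₀ ≥ 0`): the three dominations of §249 force `0 ≤ D`,
`0 ≤ U`, `0 ≤ S`. [folklore] -/
theorem clock_slip_signs (hK : 16 ≤ K) {k D₀ D U S : ℝ} (hk1 : 1 ≤ k) (hD0 : 0 ≤ D₀)
    (hD : D₀ + (1 + 10 / 9 * K ^ 4) * ((61 / 12 * k + 2 / 3) / K ^ 10 + 3 / K ^ 9) ≤ D)
    (hU : 7 / 2 + k ^ 2 / 3 + (2 * log k + 520 * log K) * D ^ 2 ≤ U)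
    (hS : (2829 / 10000 + U / K ^ 9) * (U / K ^ 9)
      + (2 * D + (2 * k + 3) / (5 * K ^ 9)) * ((2 * k + 3) / (5 * K ^ 9))
      + 6 * (D + (2 * k + 3) / (5 * K ^ 9) + 3 / K ^ 9) / K ^ 9 ≤ S) :
    0 ≤ D ∧ 0 ≤ U ∧ 0 ≤ S := by
  have hK0 : (0 : ℝ) < K := by linarith
  have hK9 : (0 : ℝ) < K ^ 9 := by positivity
  have hk0 : 0 ≤ k := by linarith
  have hJ : 0 ≤ (1 + 10 / 9 * K ^ 4) * ((61 / 12 * k + 2 / 3) / K ^ 10 + 3 / K ^ 9) := by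
    positivity
  have hDpos : 0 ≤ D := by linarith only [hD0, hJ, hD]
  have hlogc : 0 ≤ 2 * log k + 520 * log K := by
    have h1 : 0 ≤ log k := Real.log_nonneg hk1
    have h2 : 0 ≤ log K := Real.log_nonneg (by linarith)
    linarith only [h1, h2]
  have hU0 : 0 ≤ U := by
    have h1 : 0 ≤ (2 * log k + 520 * log K) * D ^ 2 := mul_nonneg hlogc (sq_nonneg D)
    have h2 : 0 ≤ k ^ 2 / 3 := by positivity
    linarith only [h1, h2, hU]
  have hι : 0 ≤ (2 * k + 3) / (5 * K ^ 9) := by positivity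
  have h3 : (0 : ℝ) ≤ 3 / K ^ 9 := by positivity
  have h1 : 0 ≤ (2829 / 10000 + U / K ^ 9) * (U / K ^ 9) := by positivity
  have h2 : 0 ≤ (2 * D + (2 * k + 3) / (5 * K ^ 9)) * ((2 * k + 3) / (5 * K ^ 9)) :=
    mul_nonneg (by linarith only [hDpos, hι]) hι
  have h4 : 0 ≤ 6 * (D + (2 * k + 3) / (5 * K ^ 9) + 3 / K ^ 9) / K ^ 9 :=
    div_nonneg (mul_nonneg (by norm_num) (by linarith only [hDpos, hι, h3])) hK9.le
  exact ⟨hDpos, hU0, by linarith only [h1, h2, h4, hS]⟩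

/-! ## §249 The clock climb -/

/-- §249 **THE CLOCK CLIMB** (headline member from `delayInit` with a trigger primitive `C`, `K
≥ 16`, `0 < ε`, `ε² ≤ 1/(6K²⁰)`, `0 < ρ`, `200ε/K²⁰ ≤ ρ²`, `K¹⁰ρ² ≤ 2ε`, `ε = kK¹⁰ρ²`).
With `λ = 43/K⁹ + 242 log K/K¹⁰`, `J = ((61/12)k + 2/3)/K¹⁰ + 3/K⁹`, `ι = (2k + 3)/(5K⁹)`:
ASSUME an anchor `r₀ ≥ 0` in normal form (`b(r₀) = θ₀ε`, `c(r₀) = ρ²/K⁹`, `P(r₀) ≤ P₁`, `0 ≤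
A₀ ≤ ã(r₀)`, `|d(r₀)| ≤ D₀`), the clock hypotheses `5/4 + (N - 1)λ ≤ θ₀ ≤ 29/20`, `(N - 1)λ ≤
0.14999`, reals `D ≥ D₀ + (1 + (10/9)K⁴)J`, `U ≥ 7/2 + k²/3 + (2 log k + 520 log K)D²`, `S ≥
(0.2829 + U/K⁹)U/K⁹ + (2D + ι)ι + 6(D + ι + 3/K⁹)/K⁹`, and the budget `P₁ + s′ + (N - 1)S ≤
1/50` (`s′` = part 66's slip, once). THEN for every `1 ≤ n ≤ N` there is a normal-form ignition
`rₙ ≥ r₀ + (n - 1)` with `5/4 + (N - n)λ ≤ θₙ ≤ 29/20`, `P(rₙ) ≤ P₁ + (n - 1)S`, `A₀ + (n -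
1)/K⁹ ≤ ã(rₙ)` and part 81 §238's two transfer invariants.
[derived: part 84 §246/§247, part 82 §239, part 81 §237/§238] -/
theorem knob_ladder_climb_clock
    (hX : ∀ t, HasDerivAt X (RotorKnob.rotorCircuit K (K ^ 10) ε ρ (X t)) t)
    (h0 : X 0 = delayInit) (hC : ∀ t, HasDerivAt C (X t 2) t) (hK : 16 ≤ K)
    (hε : 0 < ε) (hεK : ε ^ 2 ≤ 1 / (6 * K ^ 20)) (hρ : 0 < ρ)
    (hlo : 200 * ε / K ^ 20 ≤ ρ ^ 2) (hhi : K ^ 10 * ρ ^ 2 ≤ 2 * ε) (k : ℕ)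
    (hk : ε = k * K ^ 10 * ρ ^ 2) {r₀ θ₀ P₁ A₀ D₀ D U S : ℝ} {N : ℕ} (hr₀ : 0 ≤ r₀)
    (hb₀ : X r₀ 1 = θ₀ * ε) (hc₀ : X r₀ 2 = ρ ^ 2 / K ^ 9) (hP₁ : X r₀ 3 ^ 2 + X r₀ 4 ^ 2 ≤ P₁)
    (hθ₀lo : 5 / 4 + ((N : ℝ) - 1) * (43 / K ^ 9 + 242 * log K / K ^ 10) ≤ θ₀)
    (hθ₀hi : θ₀ ≤ 29 / 20)
    (hNθ : ((N : ℝ) - 1) * (43 / K ^ 9 + 242 * log K / K ^ 10) ≤ 14999 / 100000)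
    (hA0 : 0 ≤ A₀) (hA₀ : A₀ ≤ X r₀ 4) (hD₀ : |X r₀ 3| ≤ D₀)
    (hD : D₀ + (1 + 10 / 9 * K ^ 4) * ((61 / 12 * k + 2 / 3) / K ^ 10 + 3 / K ^ 9) ≤ D)
    (hU : 7 / 2 + k ^ 2 / 3 + (2 * log k + 520 * log K) * D ^ 2 ≤ U)
    (hS : (2829 / 10000 + U / K ^ 9) * (U / K ^ 9)
      + (2 * D + (2 * k + 3) / (5 * K ^ 9)) * ((2 * k + 3) / (5 * K ^ 9))
      + 6 * (D + (2 * k + 3) / (5 * K ^ 9) + 3 / K ^ 9) / K ^ 9 ≤ S)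
    (hNP : P₁ + (3 * (k * π / ((25 / 16 - 1 / 10 ^ 6) * K ^ 10 - 1) + 1 / K ^ 19
      + 310 * log K / K ^ 9) / 10 + 6 / K ^ 9) + ((N : ℝ) - 1) * S ≤ 1 / 50) :
    ∀ n : ℕ, 1 ≤ n → n ≤ N → ∃ r θ : ℝ, r₀ + ((n : ℝ) - 1) ≤ r ∧ X r 1 = θ * ε ∧
      5 / 4 + ((N : ℝ) - n) * (43 / K ^ 9 + 242 * log K / K ^ 10) ≤ θ ∧ θ ≤ 29 / 20 ∧
      X r 2 = ρ ^ 2 / K ^ 9 ∧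
      X r 3 ^ 2 + X r 4 ^ 2 ≤ P₁ + ((n : ℝ) - 1) * S ∧
      A₀ + ((n : ℝ) - 1) / K ^ 9 ≤ X r 4 ∧
      |X r 3| ≤ D₀ + ((n : ℝ) - 1) * ((61 / 12 * k + 2 / 3) / K ^ 10 + 3 / K ^ 9) ∧
      |X r 3| ≤ D₀ + (1 + 10 / 9 * K ^ 8 / n) * ((61 / 12 * k + 2 / 3) / K ^ 10 + 3 / K ^ 9) := by
  obtain ⟨hk1, -, -, hδ0, -, -⟩ := rung_numerics hK hε hρ hlo k hk
  have hK0 : (0 : ℝ) < K := by linarith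
  have hK8 : (0 : ℝ) < K ^ 8 := by positivity
  have hK9 : (0 : ℝ) < K ^ 9 := by positivity
  have hK10 : (0 : ℝ) < K ^ 10 := by positivity
  have hk0 : (0 : ℝ) ≤ k := Nat.cast_nonneg k
  obtain ⟨hl0, hfine6, -⟩ := clock_numerics hK
  obtain ⟨l, hl_def⟩ : ∃ l : ℝ, l = 43 / K ^ 9 + 242 * log K / K ^ 10 := ⟨_, rfl⟩
  rw [← hl_def] at hl0
  simp only [← hl_def] at hθ₀lo hNθ ⊢
  have hlogK : 0 ≤ log K := Real.log_nonneg (by linarith)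
  have h310 : (0 : ℝ) ≤ 310 * log K / K ^ 9 := div_nonneg (by positivity) hK9.le
  have h6 : (0 : ℝ) ≤ 6 / K ^ 9 := by positivity
  have h3 : (0 : ℝ) ≤ 3 / K ^ 9 := by positivity
  have hD0 : 0 ≤ D₀ := le_trans (abs_nonneg _) hD₀
  obtain ⟨s, hs_def⟩ : ∃ s : ℝ, s = 3 * (k * π / ((25 / 16 - 1 / 10 ^ 6) * K ^ 10 - 1)
      + 1 / K ^ 19 + 310 * log K / K ^ 9) / 10 + 6 / K ^ 9 := ⟨_, rfl⟩
  have hs0 : 0 ≤ s := by rw [hs_def]; linarith only [hδ0, h310, h6]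
  obtain ⟨J, hJ_def⟩ : ∃ J : ℝ, J = (61 / 12 * k + 2 / 3) / K ^ 10 + 3 / K ^ 9 := ⟨_, rfl⟩
  have hJ0 : 0 ≤ J := by rw [hJ_def]; positivity
  obtain ⟨ι, hι_def⟩ : ∃ ι : ℝ, ι = (2 * k + 3) / (5 * K ^ 9) := ⟨_, rfl⟩
  have hι0 : 0 ≤ ι := by rw [hι_def]; positivity
  obtain ⟨hDnn, -, hS0⟩ := clock_slip_signs hK hk1 hD0 hD hU hS
  have hlogc : 0 ≤ 2 * log k + 520 * log K := by
    have : 0 ≤ log (k : ℝ) := Real.log_nonneg hk1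
    linarith only [this, hlogK]
  simp only [← hs_def, ← hJ_def, ← hι_def] at hNP hD hS ⊢
  have hcold6 : 0 ≤ 6 * (D + ι + 3 / K ^ 9) / K ^ 9 :=
    div_nonneg (mul_nonneg (by norm_num) (by linarith only [hDnn, hι0, h3])) hK9.le
  intro n hn
  induction n, hn using Nat.le_induction with
  | base =>
    intro _
    refine ⟨r₀, θ₀, by simp, hb₀, by simpa using hθ₀lo, hθ₀hi, hc₀, by simpa using hP₁,
      by simpa using hA₀, by simpa using hD₀, ?_⟩
    have : 0 ≤ (1 + 10 / 9 * K ^ 8) * J := mul_nonneg (by positivity) hJ0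
    norm_num; linarith only [hD₀, this]
  | succ m hm ih =>
    intro hmN
    obtain ⟨r, θ, hr, hb, hθlo, hθhi, hc, hP, hA, hd1, hd2⟩ := ih (Nat.le_of_succ_le hmN)
    have hm1 : (1 : ℝ) ≤ m := by exact_mod_cast hm
    have hmN' : (m : ℝ) + 1 ≤ N := by exact_mod_cast hmN
    have hNm : 0 ≤ ((N : ℝ) - m) * l := mul_nonneg (by linarith) hl0
    have hmq : 0 ≤ (m : ℝ) * l := mul_nonneg (by linarith) hl0
    have hr0 : 0 ≤ r := by linarith only [hr₀, hr, hm1]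
    have hθ1 : 5 / 4 ≤ θ := by linarith only [hθlo, hNm]
    have hmS : ((m : ℝ) - 1) * S ≤ ((N : ℝ) - 1) * S - S := by
      have := mul_nonneg (sub_nonneg.2 hmN') hS0
      linarith only [this]
    have hP50 : X r 3 ^ 2 + X r 4 ^ 2 + s ≤ 1 / 50 := by linarith only [hP, hNP, hmS, hS0]
    have hPr : X r 3 ^ 2 + X r 4 ^ 2 + 3 * (k * π / ((25 / 16 - 1 / 10 ^ 6) * K ^ 10 - 1)
        + 1 / K ^ 19 + 310 * log K / K ^ 9) / 10 + 6 / K ^ 9 ≤ 1 / 50 := by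
      rw [hs_def] at hP50; linarith only [hP50]
    -- the pulse half (part 84 §246)
    obtain ⟨T', θ₁, hrT, -, -, -, hbT, hθ₁lo, hθ₁hi, hfloor, hcT, -, he0, hecr, hfl, hceil,
        hdT⟩ :=
      knob_pulse_half_clock hX h0 hC hK hε hεK hρ hlo hhi k hk hr0 hθ1 hθhi hb hc hPr
    have hT'0 : 0 ≤ T' := by linarith only [hr0, hrT]
    have em1 : ((m : ℝ) - 1) + 1 = m := by ring
    -- the pulse P-slip on the ledgers (part 82 §239)
    have hdD : |X r 3| ≤ D :=
      (ledger_invariant_final hK0 hJ0 (by linarith) hd1 (by rw [em1]; exact hd2)).trans hD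
    have ha0 : 0 ≤ X r 4 := le_trans (add_nonneg hA0 (div_nonneg (by linarith) hK9.le)) hA
    have haP : X r 4 ^ 2 ≤ 1 / 50 := by nlinarith only [hP50, hs0, sq_nonneg (X r 3)]
    have heT : K * X T' 4 ≤ 3 / 20 * K := by
      have h2a : X r 4 ≤ 1415 / 10000 := by nlinarith only [haP, ha0]
      have : X T' 4 ≤ 3 / 20 := by linarith only [hecr, pulse_gain_crude hK, h2a]
      nlinarith only [this, hK0]
    obtain ⟨-, hι⟩ := iota_numerics hK hk0 (mul_nonneg hK0.le he0) heT
    rw [← hι_def] at hι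
    have hdT' : |X T' 3| ≤ |X r 3| + ι := by linarith only [hdT, hι]
    have hd2D : X r 3 ^ 2 ≤ D ^ 2 := by
      have := pow_le_pow_left₀ (abs_nonneg _) hdD 2
      rwa [sq_abs] at this
    have hUr : 7 / 2 + k ^ 2 / 3 + (2 * log k + 520 * log K) * X r 3 ^ 2 ≤ U := by
      have := mul_le_mul_of_nonneg_left hd2D hlogc
      linarith only [this, hU]
    have haT' : X T' 4 ≤ X r 4 + U / K ^ 9 := by
      linarith only [hceil, div_le_div_of_nonneg_right hUr hK9.le]
    have haa' : X r 4 ≤ X T' 4 := by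
      have : (0 : ℝ) < 1 / K ^ 9 := by positivity
      linarith only [hfl, this]
    have slip := pulse_pslip ha0 haP haT' haa' hdT' hdD hι0

    -- the exit budget `P(T') ≤ 1/50`, then the cold half (part 84 §247)
    have hPT : X T' 3 ^ 2 + X T' 4 ^ 2 ≤ 1 / 50 := by
      linarith only [slip, hS, hcold6, hP, hNP, hmS, hs0]
    have hθ₁1 : 1249 / 1000 ≤ θ₁ := by linarith only [hθ₁lo, hθ1, hfine6]
    have hθ₁2 : θ₁ ≤ 3 / 2 := by linarith only [hθ₁hi, hθhi, hfine6]
    obtain ⟨tz, r', θ', ⟨htz1, -, htz2, hr'3, hcold, hc'⟩, ⟨hb', hθ'hi, hθ'lo, hpair⟩, -, hdr',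
        hmono, -, -⟩ :=
      knob_cold_half_clock hX h0 hK hε hεK hρ hhi hT'0 hθ₁1 hθ₁2 hbT hPT hfloor hcT he0
    -- the pair slip of the rung: pulse (§239) + the sharp cold law at dose level `≤ D + ι + 3/K⁹`
    have hcold' : 6 * (|X T' 3| + 3 / K ^ 9) / K ^ 9 ≤ 6 * (D + ι + 3 / K ^ 9) / K ^ 9 :=
      div_le_div_of_nonneg_right (by linarith only [hdT', hdD]) hK9.le
    have hP's : X r' 3 ^ 2 + X r' 4 ^ 2 ≤ X r 3 ^ 2 + X r 4 ^ 2 + S := by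
      have h1 := (abs_le.1 hpair).2
      linarith only [h1, hcold', slip, hS]
    -- the three ledger invariants (part 81 §238 verbatim)
    obtain ⟨x, hx⟩ : ∃ x : ℝ, x = K * X T' 4 := ⟨_, rfl⟩
    have hmK : (m : ℝ) / K ^ 9 ≤ X T' 4 := by
      have e : ((m : ℝ) - 1) / K ^ 9 + 1 / K ^ 9 = (m : ℝ) / K ^ 9 := by ring
      linarith only [hA, hfl, hA0, e]
    have hxm : (m : ℝ) / K ^ 8 ≤ x := by
      have e : K * ((m : ℝ) / K ^ 9) = (m : ℝ) / K ^ 8 := by field_simp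
      rw [hx, ← e]; exact mul_le_mul_of_nonneg_left hmK hK0.le
    have hx0 : 0 ≤ x := le_trans (by positivity) hxm
    have hq0 : 0 ≤ exp (-(9 / 4 * x)) := (exp_pos _).le
    have hq1 : exp (-(9 / 4 * x)) ≤ 1 := by rw [Real.exp_le_one_iff]; linarith
    have hinj : exp (-(9 / 4 * x)) * (5 * k + (k / 2 + 4) * x) ≤ 61 / 12 * k + 2 / 3 := by
      have f1 := mul_le_of_le_one_left (by positivity : (0 : ℝ) ≤ 5 * k) hq1
      have f2 := mul_le_mul_of_nonneg_left (injection_numerics x)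
        (by positivity : (0 : ℝ) ≤ k / 2 + 4)
      linarith [f1, f2]
    have hinj' : exp (-(9 / 4 * x)) * ((5 * k + (k / 2 + 4) * x) / K ^ 10)
        ≤ (61 / 12 * k + 2 / 3) / K ^ 10 := by
      rw [← mul_div_assoc]; exact div_le_div_of_nonneg_right hinj hK10.le
    rw [← hx] at hdT hdr'
    have hprod := mul_le_mul_of_nonneg_right hdT hq0
    have hrec : |X r' 3| ≤ exp (-(9 / 4 * x)) * |X r 3| + J := by
      rw [hJ_def]; linarith [hdr', hprod, hinj']
    have hy : 9 / 4 * (((m : ℝ) - 1) + 1) / K ^ 8 ≤ 9 / 4 * x := by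
      rw [em1, mul_div_assoc]; linarith only [hxm]
    obtain ⟨hd1', hd2'⟩ := ledger_invariant_step hK0 hJ0 hD0 (abs_nonneg _) (by linarith) hy
      hd1 (by rw [em1]; exact hd2) hrec
    have em : ((m : ℝ) - 1) + 2 = (m : ℝ) + 1 := by ring
    rw [em] at hd2'

    refine ⟨r', θ', ?_, hb', ?_, by linarith only [hθ'hi], hc', ?_, ?_, ?_, ?_⟩
    · push_cast; linarith only [hr, hrT, htz1, htz2]
    · push_cast
      rcases hθ'lo with h | h
      · linarith only [hθlo, h, hθ₁lo, hl_def]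
      · linarith only [hNθ, h, hmq]
    · push_cast; linarith only [hP, hP's]
    · have e' : (((m + 1 : ℕ) : ℝ) - 1) / K ^ 9 = ((m : ℝ) - 1) / K ^ 9 + 1 / K ^ 9 := by
        push_cast; ring
      have hTr' : T' ≤ r' := by linarith only [htz1, htz2]
      linarith only [hA, hfl, hmono, e']
    · push_cast; linarith only [hd1']
    · push_cast; exact hd2'

/-- §249 **THE CLOCK LADDER, READ OUT**: under §249 `knob_ladder_climb_clock`'s hypotheses, at
every rung `1 ≤ n ≤ N` the ignition `rₙ ≥ r₀ + (n - 1)` is in normal form with `5/4 ≤ θₙ ≤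
29/20` and the pair is pinned from both sides, uniformly in `n`: `P(rₙ) ≤ P₁ + (n - 1)·S ≤
1/50`, `A₀ + (n - 1)/K⁹ ≤ ã(rₙ) ≤ 0.1415`, `|d(rₙ)| ≤ D`. [derived: this file §249, part 81
§237] -/
theorem knob_ladder_clock
    (hX : ∀ t, HasDerivAt X (RotorKnob.rotorCircuit K (K ^ 10) ε ρ (X t)) t)
    (h0 : X 0 = delayInit) (hC : ∀ t, HasDerivAt C (X t 2) t) (hK : 16 ≤ K)
    (hε : 0 < ε) (hεK : ε ^ 2 ≤ 1 / (6 * K ^ 20)) (hρ : 0 < ρ)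
    (hlo : 200 * ε / K ^ 20 ≤ ρ ^ 2) (hhi : K ^ 10 * ρ ^ 2 ≤ 2 * ε) (k : ℕ)
    (hk : ε = k * K ^ 10 * ρ ^ 2) {r₀ θ₀ P₁ A₀ D₀ D U S : ℝ} {N : ℕ} (hr₀ : 0 ≤ r₀)
    (hb₀ : X r₀ 1 = θ₀ * ε) (hc₀ : X r₀ 2 = ρ ^ 2 / K ^ 9) (hP₁ : X r₀ 3 ^ 2 + X r₀ 4 ^ 2 ≤ P₁)
    (hθ₀lo : 5 / 4 + ((N : ℝ) - 1) * (43 / K ^ 9 + 242 * log K / K ^ 10) ≤ θ₀)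
    (hθ₀hi : θ₀ ≤ 29 / 20)
    (hNθ : ((N : ℝ) - 1) * (43 / K ^ 9 + 242 * log K / K ^ 10) ≤ 14999 / 100000)
    (hA0 : 0 ≤ A₀) (hA₀ : A₀ ≤ X r₀ 4) (hD₀ : |X r₀ 3| ≤ D₀)
    (hD : D₀ + (1 + 10 / 9 * K ^ 4) * ((61 / 12 * k + 2 / 3) / K ^ 10 + 3 / K ^ 9) ≤ D)
    (hU : 7 / 2 + k ^ 2 / 3 + (2 * log k + 520 * log K) * D ^ 2 ≤ U)
    (hS : (2829 / 10000 + U / K ^ 9) * (U / K ^ 9)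
      + (2 * D + (2 * k + 3) / (5 * K ^ 9)) * ((2 * k + 3) / (5 * K ^ 9))
      + 6 * (D + (2 * k + 3) / (5 * K ^ 9) + 3 / K ^ 9) / K ^ 9 ≤ S)
    (hNP : P₁ + (3 * (k * π / ((25 / 16 - 1 / 10 ^ 6) * K ^ 10 - 1) + 1 / K ^ 19
      + 310 * log K / K ^ 9) / 10 + 6 / K ^ 9) + ((N : ℝ) - 1) * S ≤ 1 / 50) :
    ∀ n : ℕ, 1 ≤ n → n ≤ N → ∃ r θ : ℝ, r₀ + ((n : ℝ) - 1) ≤ r ∧ X r 1 = θ * ε ∧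
      5 / 4 ≤ θ ∧ θ ≤ 29 / 20 ∧ X r 2 = ρ ^ 2 / K ^ 9 ∧
      X r 3 ^ 2 + X r 4 ^ 2 ≤ P₁ + ((n : ℝ) - 1) * S ∧ X r 3 ^ 2 + X r 4 ^ 2 ≤ 1 / 50 ∧
      A₀ + ((n : ℝ) - 1) / K ^ 9 ≤ X r 4 ∧ X r 4 ≤ 1415 / 10000 ∧ |X r 3| ≤ D := by
  intro n hn hnN
  obtain ⟨r, θ, hr, hb, hθlo, hθhi, hc, hP, hA, hd1, hd2⟩ := knob_ladder_climb_clock hX h0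
    hC hK hε hεK hρ hlo hhi k hk hr₀ hb₀ hc₀ hP₁ hθ₀lo hθ₀hi hNθ hA0 hA₀ hD₀ hD hU hS hNP n hn
    hnN
  obtain ⟨hk1, -, -, hδ0, -, -⟩ := rung_numerics hK hε hρ hlo k hk
  have hK0 : (0 : ℝ) < K := by linarith
  have hK9 : (0 : ℝ) < K ^ 9 := by positivity
  have hn1 : (1 : ℝ) ≤ n := by exact_mod_cast hn
  have hnN' : (n : ℝ) ≤ N := by exact_mod_cast hnN
  obtain ⟨hl0, -, -⟩ := clock_numerics hK
  obtain ⟨-, -, hS0⟩ := clock_slip_signs hK hk1 ((abs_nonneg _).trans hD₀) hD hU hS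
  have h310 : (0 : ℝ) ≤ 310 * log K / K ^ 9 :=
    div_nonneg (mul_nonneg (by norm_num) (Real.log_nonneg (by linarith))) hK9.le
  have hθ : 5 / 4 ≤ θ := by
    have := mul_nonneg (sub_nonneg.2 hnN') hl0
    linarith only [hθlo, this]
  have hP50 : X r 3 ^ 2 + X r 4 ^ 2 ≤ 1 / 50 := by
    have h1 : ((n : ℝ) - 1) * S ≤ ((N : ℝ) - 1) * S :=
      mul_le_mul_of_nonneg_right (by linarith only [hnN']) hS0
    have h2 : (0 : ℝ) ≤ 6 / K ^ 9 := by positivity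
    linarith only [hP, h1, hNP, hδ0, h310, h2]
  have ha0 : 0 ≤ X r 4 := le_trans (add_nonneg hA0 (div_nonneg (by linarith) hK9.le)) hA
  have ha : X r 4 ≤ 1415 / 10000 := by nlinarith only [hP50, ha0, sq_nonneg (X r 3)]
  have e : ((n : ℝ) - 1) + 1 = n := by ring
  have hd : |X r 3| ≤ D :=
    (ledger_invariant_final hK0 (by positivity) (by linarith) hd1 (by rw [e]; exact hd2)).trans hD
  exact ⟨r, θ, hr, hb, hθ, hθhi, hc, hP, hP50, hA, ha, hd⟩

end Summit.NavierStokesRegularity.FluidComputer.GateBudget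

end
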